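import Summits.KontsevichZagierPeriods.KontsevichZagierPeriods.Theorems.PlanarK0Injective.Negative.Kit

/-!
# `PlanarK0Injective` (stmt-KontsevichZagierPeriods-9847): negative side — VI. boundedness is not a one-move invariant

Refuter `cdisprove` (gen 2, cycle 2). `horn_sub_openUnitSquare_mem_changeOfVariablesRel`: the UNBOUNDED
horn `{x > 1, 0 < y < 1/x²}` is ONE change-of-variables move away from the open unit square
(`Φ(x,y) = (1/x, x²y)`, rational over ℚ, injective, `det DΦ = −1`); its area is obtained from Mathlib's
Jacobian formula (`volume_hornSet`), and `not_isBounded_hornSet` / `isBounded_openUnitSquare` record the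
contrast. With `OneMove.lean` (compactness and preconnectedness ARE one-move invariants, by continuity of
the move map on its source) this completes the one-move geography found so far: the only one-move
obstructions are point-set topological and vanish after one cut; boundedness is not even that.
[Kontsevich–Zagier 2001, §1.2]
-/

noncomputable section

open MeasureTheory Set MvPolynomial
open Literature.NumberTheory.Transcendental Literature.ModelTheory.ExponentialFields

namespace Summit.KontsevichZagierPeriods.SymplecticScissors.PlanarK0InjectiveNegative

open Summit.KontsevichZagierPeriods.KontsevichZagierPeriods.Theses.SymplecticScissors (PlanarK0Injective)

/-- Coordinate projections of the plane as continuous linear forms (file-local name). [folklore] -/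
abbrev hpr (i : Fin 2) : (Fin 2 → ℝ) →L[ℝ] ℝ :=
  ContinuousLinearMap.proj (R := ℝ) (φ := fun _ : Fin 2 => ℝ) i

/-! ## §8 Boundedness is not a one-move invariant: the horn is ONE move from the square -/

/-- The unbounded horn `{x > 1, 0 < y, x² y < 1}` (area `1`). [folklore] -/
def hornSet : Set (Fin 2 → ℝ) := {p | 1 < p 0 ∧ 0 < p 1 ∧ p 0 ^ 2 * p 1 < 1}

/-- Auxiliary: `isSemialgebraic_hornSet`. [folklore] -/
theorem isSemialgebraic_hornSet : IsSemialgebraic ℚ hornSet := by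
  have h := ((isSemialgebraic_setOf_eval_lt (k := ℚ) (R := ℝ) (ι := Fin 2) (C 1) (X 0)).inter
    (isSemialgebraic_setOf_eval_lt (k := ℚ) (R := ℝ) (ι := Fin 2) (C 0) (X 1))).inter
    (isSemialgebraic_setOf_eval_lt (k := ℚ) (R := ℝ) (ι := Fin 2) (X 0 ^ 2 * X 1) (C 1))
  have hEq : hornSet =
      ({x : Fin 2 → ℝ | aeval x (C 1 : MvPolynomial (Fin 2) ℚ) < aeval x (X 0 : MvPolynomial (Fin 2) ℚ)} ∩
      {x : Fin 2 → ℝ | aeval x (C 0 : MvPolynomial (Fin 2) ℚ) < aeval x (X 1 : MvPolynomial (Fin 2) ℚ)}) ∩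
      {x : Fin 2 → ℝ | aeval x (X 0 ^ 2 * X 1 : MvPolynomial (Fin 2) ℚ) < aeval x (C 1 : MvPolynomial (Fin 2) ℚ)} := by
    ext p
    simp [hornSet, and_assoc]
  rw [hEq]; exact h

/-- The compactification map `Φ(x, y) = (1/x, x² y)` (`det DΦ = −1`). [folklore] -/
def hornMap : (Fin 2 → ℝ) → (Fin 2 → ℝ) := fun p => ![(p 0)⁻¹, p 0 ^ 2 * p 1]

/-- Its derivative at `p`: `v ↦ (−v₀/x², 2xy·v₀ + x²·v₁)`. [folklore] -/
def hornMapDeriv (p : Fin 2 → ℝ) : (Fin 2 → ℝ) →L[ℝ] (Fin 2 → ℝ) :=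
  ContinuousLinearMap.pi ![-(p 0 ^ 2)⁻¹ • hpr 0, (2 * p 0 * p 1) • hpr 0 + (p 0 ^ 2) • hpr 1]

/-- Auxiliary: `hornMapDeriv_apply`. [folklore] -/
theorem hornMapDeriv_apply (p v : Fin 2 → ℝ) :
    hornMapDeriv p v = ![-(p 0 ^ 2)⁻¹ * v 0, 2 * p 0 * p 1 * v 0 + p 0 ^ 2 * v 1] := by
  ext i
  fin_cases i <;> simp [hornMapDeriv]

/-- Auxiliary: `hasFDerivAt_hornMap_fst`. [folklore] -/
theorem hasFDerivAt_hornMap_fst {p : Fin 2 → ℝ} (hp : p 0 ≠ 0) :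
    HasFDerivAt (fun q : Fin 2 → ℝ => (q 0)⁻¹) (-(p 0 ^ 2)⁻¹ • hpr 0) p := by
  have h := (hasFDerivAt_inv (𝕜 := ℝ) hp).comp p ((hpr 0).hasFDerivAt (x := p))
  refine h.congr_fderiv ?_
  ext v
  simp [ContinuousLinearMap.toSpanSingleton_apply, mul_comm]

/-- Auxiliary: `hasFDerivAt_hornMap_snd`. [folklore] -/
theorem hasFDerivAt_hornMap_snd (p : Fin 2 → ℝ) :
    HasFDerivAt (fun q : Fin 2 → ℝ => q 0 ^ 2 * q 1) ((2 * p 0 * p 1) • hpr 0 + (p 0 ^ 2) • hpr 1) p := by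
  have h := (((hpr 0).hasFDerivAt (x := p)).pow 2).mul ((hpr 1).hasFDerivAt (x := p))
  refine h.congr_fderiv ?_
  ext v
  simp
  ring

/-- Auxiliary: `hasFDerivAt_hornMap`. [folklore] -/
theorem hasFDerivAt_hornMap {p : Fin 2 → ℝ} (hp : p 0 ≠ 0) : HasFDerivAt hornMap (hornMapDeriv p) p := by
  rw [hasFDerivAt_pi']
  refine Fin.forall_fin_two.mpr ⟨?_, ?_⟩
  · have e : -(p 0 ^ 2)⁻¹ • hpr 0 = (hpr 0).comp (hornMapDeriv p) := by
      ext v; simp [hornMapDeriv]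
    exact (hasFDerivAt_hornMap_fst hp).congr_fderiv e
  · have e : (2 * p 0 * p 1) • hpr 0 + (p 0 ^ 2) • hpr 1 = (hpr 1).comp (hornMapDeriv p) := by
      ext v; simp [hornMapDeriv]
    exact (hasFDerivAt_hornMap_snd p).congr_fderiv e

/-- Auxiliary: `det_hornMapDeriv`. [folklore] -/
theorem det_hornMapDeriv {p : Fin 2 → ℝ} (hp : p 0 ≠ 0) : (hornMapDeriv p).det = -1 := by
  have h : (hornMapDeriv p : (Fin 2 → ℝ) →ₗ[ℝ] (Fin 2 → ℝ)) =
      Matrix.toLin' !![-(p 0 ^ 2)⁻¹, 0; 2 * p 0 * p 1, p 0 ^ 2] := by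
    apply LinearMap.ext
    intro v
    rw [ContinuousLinearMap.coe_coe, hornMapDeriv_apply, Matrix.toLin'_apply]
    ext i
    fin_cases i <;> simp [Matrix.mulVec, dotProduct, Fin.sum_univ_two]
  rw [ContinuousLinearMap.det, h, LinearMap.det_toLin', Matrix.det_fin_two]
  have h2 : p 0 ^ 2 ≠ 0 := pow_ne_zero 2 hp
  simp [h2]

/-- Auxiliary: `isSemialgebraicMapOn_hornMap`. [folklore] -/
theorem isSemialgebraicMapOn_hornMap : IsSemialgebraicMapOn ℚ hornSet hornMap := by
  refine IsSemialgebraicMapOn.of_forall isSemialgebraic_hornSet (Fin.forall_fin_two.mpr ⟨?_, ?_⟩)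
  · refine (isSemialgebraicFunOn_aeval_div_aeval isSemialgebraic_hornSet (C 1) (X 0) ?_).congr ?_
    · intro x hx
      have h1 : 1 < x 0 := hx.1
      simp only [aeval_X, ne_eq]
      exact ne_of_gt (by linarith)
    · intro x _
      simp [hornMap]
  · exact (isSemialgebraicFunOn_aeval isSemialgebraic_hornSet (X 0 ^ 2 * X 1)).congr
      fun x _ => by simp [hornMap]

/-- Auxiliary: `injOn_hornMap`. [folklore] -/
theorem injOn_hornMap : InjOn hornMap hornSet := by
  intro p hp q hq h
  have hp0 : p 0 ≠ 0 := ne_of_gt (by linarith [hp.1])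
  have hq0 : q 0 ≠ 0 := ne_of_gt (by linarith [hq.1])
  have h0 := congrFun h 0
  have h1 := congrFun h 1
  simp only [hornMap, Matrix.cons_val_zero, Matrix.cons_val_one, inv_inj] at h0 h1
  rw [h0] at h1
  have h1' : p 1 = q 1 := by
    have := mul_left_cancel₀ (pow_ne_zero 2 hq0) h1
    exact this
  ext i
  fin_cases i
  · exact h0
  · exact h1'

/-- Auxiliary: `image_hornMap_hornSet` — the horn goes onto the open unit square. [folklore] -/
theorem image_hornMap_hornSet : hornMap '' hornSet = openUnitSquare.domain := by
  ext q
  rw [mem_openUnitSquare]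
  constructor
  · rintro ⟨p, ⟨h0, h1, h2⟩, rfl⟩
    have hp0 : 0 < p 0 := by linarith
    refine ⟨⟨?_, ?_⟩, ?_, ?_⟩
    · simp only [hornMap, Matrix.cons_val_zero]; exact inv_pos.mpr hp0
    · simp only [hornMap, Matrix.cons_val_zero]; exact inv_lt_one_of_one_lt₀ h0
    · simp only [hornMap, Matrix.cons_val_one, Matrix.cons_val_zero]; positivity
    · simpa [hornMap] using h2
  · rintro ⟨⟨h0, h1⟩, h2, h3⟩
    have hq0 : q 0 ≠ 0 := h0.ne'
    refine ⟨![(q 0)⁻¹, q 0 ^ 2 * q 1], ⟨?_, ?_, ?_⟩, ?_⟩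
    · simp; exact one_lt_inv_iff₀.mpr ⟨h0, h1⟩
    · simp; positivity
    · simp; field_simp; exact h3
    · simp only [hornMap]
      ext i
      fin_cases i
      · simp
      · simp; field_simp

/-- Auxiliary: `measurableSet_hornSet`. [folklore] -/
theorem measurableSet_hornSet : MeasurableSet hornSet :=
  IsSemialgebraic.measurableSet_holds isSemialgebraic_hornSet

/-- Auxiliary: `ne_zero_of_mem_hornSet`. [folklore] -/
theorem ne_zero_of_mem_hornSet {p : Fin 2 → ℝ} (hp : p ∈ hornSet) : p 0 ≠ 0 :=
  ne_of_gt (lt_trans zero_lt_one hp.1)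

/-- The horn has the area of the unit square (Jacobian formula for the compactification map,
`|det| = 1`): in particular it has finite area although it is unbounded. [folklore] -/
theorem volume_hornSet : volume hornSet = volume openUnitSquare.domain := by
  have h := lintegral_abs_det_fderiv_eq_addHaar_image volume measurableSet_hornSet
    (fun p hp => (hasFDerivAt_hornMap (ne_zero_of_mem_hornSet hp)).hasFDerivWithinAt) injOn_hornMap
  rw [image_hornMap_hornSet] at h
  rw [← h]
  have hcongr : EqOn (fun p => ENNReal.ofReal |(hornMapDeriv p).det|) (fun _ => 1) hornSet :=
    fun p hp => by simp [det_hornMapDeriv (ne_zero_of_mem_hornSet hp)]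
  rw [setLIntegral_congr_fun measurableSet_hornSet hcongr]
  simp

/-- The horn as a planar set (integrand `1`, area `1`). [folklore] -/
def hornRep : KZ.IntegralRep 2 where
  domain := hornSet
  integrand := fun _ => 1
  isSemialgebraic_domain := isSemialgebraic_hornSet
  isSemialgebraicFunOn_integrand := isSemialgebraicFunOn_one isSemialgebraic_hornSet
  integrableOn := integrableOn_const (by rw [volume_hornSet]; exact volume_box_ne_top _ _)

/-- The horn is unbounded. [folklore] -/
theorem not_isBounded_hornSet : ¬ Bornology.IsBounded hornSet := by
  intro h
  obtain ⟨C, hC⟩ := isBounded_iff_forall_norm_le.mp h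
  set t : ℝ := max C 1 + 1 with ht
  have ht1 : 1 < t := by have := le_max_right C 1; linarith
  have htC : C < t := by have := le_max_left C 1; linarith
  have ht0 : 0 < t := by linarith
  have hmem : (![t, (2 * t ^ 2)⁻¹] : Fin 2 → ℝ) ∈ hornSet := by
    refine ⟨by simpa using ht1, by simp; positivity, ?_⟩
    have : t ^ 2 * (2 * t ^ 2)⁻¹ = 1 / 2 := by field_simp
    simp only [Matrix.cons_val_zero, Matrix.cons_val_one, this]
    norm_num
  have hle := (norm_le_pi_norm (![t, (2 * t ^ 2)⁻¹] : Fin 2 → ℝ) 0).trans (hC _ hmem)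
  simp only [Matrix.cons_val_zero, Real.norm_eq_abs, abs_of_pos ht0] at hle
  linarith

/-- The open unit square is bounded. [folklore] -/
theorem isBounded_openUnitSquare : Bornology.IsBounded openUnitSquare.domain :=
  isCompact_Icc.isBounded.subset (box_subset_Icc _ _)

/-- **BOUNDEDNESS IS NOT A ONE-MOVE INVARIANT (calibration).** The unbounded horn
`{x > 1, 0 < y < 1/x²}` and the open unit square differ by ONE change-of-variables move, the
compactification `Φ(x, y) = (1/x, x²y)` (rational over ℚ, injective, `det DΦ = −1`). Contrast §3:
compactness and preconnectedness ARE one-move invariants (continuity of the move map on its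
source). So "bounded vs unbounded" offers a disprover nothing, not even at chain length one. [folklore] -/
theorem horn_sub_openUnitSquare_mem_changeOfVariablesRel :
    KZ.of hornRep - KZ.of openUnitSquare ∈ KZ.changeOfVariablesRel :=
  ⟨2, hornRep, openUnitSquare, hornMap, hornMapDeriv, isSemialgebraicMapOn_hornMap,
    fun p hp => (hasFDerivAt_hornMap (ne_zero_of_mem_hornSet hp)).hasFDerivWithinAt, injOn_hornMap,
    image_hornMap_hornSet.symm,
    fun p hp => by simp [hornRep, det_hornMapDeriv (ne_zero_of_mem_hornSet hp)], rfl⟩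

/-- Hence the horn and the square are congruent in the planar set-chain group. [folklore] -/
theorem horn_sub_openUnitSquare_mem_planarGroup :
    KZ.of hornRep - KZ.of openUnitSquare ∈ planarGroup :=
  AddSubgroup.subset_closure ⟨Or.inr horn_sub_openUnitSquare_mem_changeOfVariablesRel,
    (AddSubgroup.closure planarGens).sub_mem (AddSubgroup.subset_closure ⟨_, fun _ _ => rfl, rfl⟩)
      (AddSubgroup.subset_closure ⟨_, fun _ _ => rfl, rfl⟩)⟩

end Summit.KontsevichZagierPeriods.SymplecticScissors.PlanarK0InjectiveNegative
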